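import Summits.Ventures.DiscreteObjects.PP12.FlagSevenOrbitDataOfPlane
import Summits.Ventures.DiscreteObjects.PP12.FlagTenConjunctR2
import Summits.Ventures.DiscreteObjects.PP12.FlagTenConjunctC4

/-!
# The `f = 7` flag-cell orbit matrix: the rows ARE the non-trivial line orbits (kernel; Step C₁ of the FlagSevenOrbitReduction roadmap, continued)
Framing: lottery ticket; floor = certified bounds/negative ranges.

Cell pub-namedobj (venture DiscreteObjects), target (M), designs gen 14. Setting as in `FlagSevenOrbitDataOfPlane` (sibling: `FlagSevenColOrbits` for the
columns). For the row indexing `rowOrbit : F7Row → Finset L` (`Γ_s = orb3 (cl s)`, side orbits `orb3 (sideOf x_{s,i})`, T-line orbits `(k,t)` through `y_k`):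
`rowOrbit_mem_lineOrbits3` (every value is a non-trivial line orbit), `rowOrbit_injective` (`u₁ ∉ orb3 u₀`), `exists_rowOrbit_eq` (every non-trivial
line orbit is a row: a non-fixed line is a c-line of class `0`/`1`, a T-line through a fixed `y ≠ c`, or an exterior line = a side of a triangle
with a vertex on `u₀` or `u₁`). So `Σ_{r : F7Row}` is `Σ_{B ∈ lineOrbits3 σ}` (`OrbitSideIdentities.orbit_column_identity_orbits`). Also: the representative lines `lineRep`
(`rowOrbit_eq_orb3_lineRep`) and the small tools `not_mem_orb3_of_fixed`, `card_filter_orb3_on_fixedLine`, `triIdx_class_unique` used by the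
entry files. No `sorry`, no new axioms.
-/

namespace Summit.Ventures.DiscreteObjects.PP12

open Configuration Finset
open scoped Classical

namespace Collineation

variable {P L : Type*} [Membership P L] [ProjectivePlane P L] [Fintype P] [Fintype L] (σ : Collineation P L)

omit [ProjectivePlane P L] [Fintype P] [Fintype L] in
/-- A fixed point lies in no orbit of a non-fixed point. -/
theorem not_mem_orb3_of_fixed {y p : P} (hy : σ.onPoints y = y) (hp : σ.onPoints p ≠ p) : y ∉ orb3 σ.onPoints p :=
  fun h => (σ.not_fixed_of_mem_orb3 hp h) hy

omit [Fintype P] [Fintype L] in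
/-- **A line `a ≠ m` meets an orbit of points of the fixed line `m` in `[a ∩ m ∈ orbit]` points.** -/
theorem card_filter_orb3_on_fixedLine {c : P} {m : L} (hm : σ.onLines m = m) {a : L} (ham : a ≠ m) {p : P} (hpm : p ∈ m) :
    ((orb3 σ.onPoints p).filter fun q => q ∈ a).card = if meetPt c a m ∈ orb3 σ.onPoints p then 1 else 0 := by
  have hsub : (orb3 σ.onPoints p).filter (fun q => q ∈ a) ⊆ {meetPt c a m} := by
    intro q hq
    rw [mem_filter] at hq
    rw [mem_singleton]
    exact meetPt_eq c ham hq.2 (σ.mem_fixedLine_of_mem_orb3 hm hpm hq.1)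
  split_ifs with h
  · apply le_antisymm
    · exact (card_le_card hsub).trans (by rw [card_singleton])
    · exact card_pos.2 ⟨meetPt c a m, mem_filter.2 ⟨h, (meetPt_spec c ham).1⟩⟩
  · rw [card_eq_zero, filter_eq_empty_iff]
    intro q hq hqa
    apply h
    rw [← meetPt_eq c ham hqa (σ.mem_fixedLine_of_mem_orb3 hm hpm hq)]
    exact hq

section Flag

variable {l : L} {c : P} (hl : σ.onLines l = l) (hc : σ.onPoints c = c) (hcl : c ∈ l)
  (hP : ∀ p : P, σ.onPoints p = p → p ∈ l) (hL : ∀ m : L, σ.onLines m = m → c ∈ m)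
  (h12 : ProjectivePlane.order P L = 12)

omit [Fintype P] [Fintype L] in
include hc in
/-- **No triangle has vertices of both classes:** a point `≠ c` of `cl s` in the orbit of a vertex of class `s' ≠ s` is impossible. -/
theorem triIdx_class_unique (hq : σ.onPoints ^ 3 = 1) {u₀ u₁ : L} (hcu₀ : c ∈ u₀) (hu₀ : σ.onLines u₀ ≠ u₀) (hcu₁ : c ∈ u₁)
    (h01 : u₁ ∉ orb3 σ.onLines u₀) {s s' : Fin 2} (hss : s ≠ s') (x' : TriIdx (P := P) c (cl u₀ u₁ s'))
    {p : P} (hp : p ∈ orb3 σ.onPoints x'.1) (hpu : p ∈ cl u₀ u₁ s) (hpc : p ≠ c) : False := by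
  fin_cases s <;> fin_cases s'
  · exact hss rfl
  · exact σ.not_both_classes hc hq hcu₀ hu₀ hcu₁ h01 hp hpu hpc (self_mem_orb3 _ x'.1) x'.2.1
  · exact σ.not_both_classes hc hq hcu₀ hu₀ hcu₁ h01 (self_mem_orb3 _ x'.1) x'.2.1 x'.2.2 hp hpu
  · exact hss rfl

section Data

variable (hl : σ.onLines l = l) (hc : σ.onPoints c = c) (hcl : c ∈ l)
  (hP : ∀ p : P, σ.onPoints p = p → p ∈ l) (hL : ∀ m : L, σ.onLines m = m → c ∈ m) (h12 : ProjectivePlane.order P L = 12)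
  (hq : σ.onPoints ^ 3 = 1) (hf : fixedCard σ.onPoints = 7) {u₀ u₁ : L} (hcu₀ : c ∈ u₀) (hu₀ : σ.onLines u₀ ≠ u₀)
  (hcu₁ : c ∈ u₁) (hu₁ : σ.onLines u₁ ≠ u₁)

/-- **The line orbit of a row** of the `f = 7` orbit matrix. -/
noncomputable def rowOrbit : F7Row → Finset L
  | Sum.inl s => orb3 σ.onLines (cl u₀ u₁ s)
  | Sum.inr (Sum.inl (s, i)) => orb3 σ.onLines (σ.sideOf l (σ.eTri7 h12 hcu₀ hu₀ hcu₁ hu₁ s i).1)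
  | Sum.inr (Sum.inr (k, t)) => (σ.eLOrb hl hcl hP hL h12 hq (σ.eFixP6 hl hc hf k) t).1

/-- **A representative line of each row orbit**: `cl s`, the side `sideOf x_{s,i}`, a chosen T-line of the orbit `(k,t)`. -/
noncomputable def lineRep : F7Row → L
  | Sum.inl s => cl u₀ u₁ s
  | Sum.inr (Sum.inl (s, i)) => σ.sideOf l (σ.eTri7 h12 hcu₀ hu₀ hcu₁ hu₁ s i).1
  | Sum.inr (Sum.inr (k, t)) => (mem_image.1 (σ.eLOrb hl hcl hP hL h12 hq (σ.eFixP6 hl hc hf k) t).2).choose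

/-- The chosen T-line of the orbit `(k,t)` passes through `y_k`, is `≠ l`, and generates the orbit. -/
theorem lineRep_tline_spec (k : Fin 6) (t : Fin 4) :
    (σ.eFixP6 hl hc hf k).1 ∈ σ.lineRep hl hc hcl hP hL h12 hq hf hcu₀ hu₀ hcu₁ hu₁ (Sum.inr (Sum.inr (k, t))) ∧
      σ.lineRep hl hc hcl hP hL h12 hq hf hcu₀ hu₀ hcu₁ hu₁ (Sum.inr (Sum.inr (k, t))) ≠ l ∧
      orb3 σ.onLines (σ.lineRep hl hc hcl hP hL h12 hq hf hcu₀ hu₀ hcu₁ hu₁ (Sum.inr (Sum.inr (k, t))))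
        = (σ.eLOrb hl hcl hP hL h12 hq (σ.eFixP6 hl hc hf k) t).1 := by
  have hspec := (mem_image.1 (σ.eLOrb hl hcl hP hL h12 hq (σ.eFixP6 hl hc hf k) t).2).choose_spec
  rw [mem_filter] at hspec
  exact ⟨hspec.1.2.1, hspec.1.2.2, hspec.2⟩

/-- Every row orbit is the orbit of its representative line. -/
theorem rowOrbit_eq_orb3_lineRep (r : F7Row) :
    σ.rowOrbit hl hc hcl hP hL h12 hq hf hcu₀ hu₀ hcu₁ hu₁ r = orb3 σ.onLines (σ.lineRep hl hc hcl hP hL h12 hq hf hcu₀ hu₀ hcu₁ hu₁ r) := by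
  rcases r with s | ⟨s, i⟩ | ⟨k, t⟩
  · rfl
  · rfl
  · exact (σ.lineRep_tline_spec hl hc hcl hP hL h12 hq hf hcu₀ hu₀ hcu₁ hu₁ k t).2.2.symm

/-! ### Rows -/

/-- Every row orbit is a non-trivial line orbit. -/
theorem rowOrbit_mem_lineOrbits3 (r : F7Row) : σ.rowOrbit hl hc hcl hP hL h12 hq hf hcu₀ hu₀ hcu₁ hu₁ r ∈ σ.lineOrbits3 := by
  unfold lineOrbits3
  rcases r with s | ⟨s, i⟩ | ⟨k, t⟩
  · exact mem_image.2 ⟨_, mem_filter.2 ⟨mem_univ _, (σ.cl_spec hcu₀ hu₀ hcu₁ hu₁ s).2⟩, rfl⟩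
  · set x := σ.eTri7 h12 hcu₀ hu₀ hcu₁ hu₁ s i with hx
    have hxX := σ.exterior_of_triIdx s x hcu₀ hu₀ hcu₁ hu₁ hL
    have hxf : σ.onPoints x.1 ≠ x.1 := σ.not_fixed_of_exterior_flag hl hP hxX
    obtain ⟨hxa, hσxa⟩ := σ.sideOf_spec l hxf
    exact mem_image.2 ⟨_, mem_filter.2 ⟨mem_univ _, (σ.side_no_fixed_point hxf hxX hxa hσxa).1⟩, rfl⟩
  · set y := σ.eFixP6 hl hc hf k with hy
    obtain ⟨b, hb, hbeq⟩ := mem_image.1 (σ.eLOrb hl hcl hP hL h12 hq y t).2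
    rw [mem_filter] at hb
    exact mem_image.2 ⟨b, mem_filter.2 ⟨mem_univ _, σ.tline_not_fixed hcl hP hL y.2.1 y.2.2 hb.2.1 hb.2.2⟩, hbeq⟩

/-- **The row indexing is injective** (`u₁ ∉ orb3 u₀`). -/
theorem rowOrbit_injective (h01 : u₁ ∉ orb3 σ.onLines u₀) :
    Function.Injective (σ.rowOrbit hl hc hcl hP hL h12 hq hf hcu₀ hu₀ hcu₁ hu₁) := by
  have hqL : σ.onLines ^ 3 = 1 := σ.onLines_pow_eq_one hq
  intro r₁ r₂ h
  -- facts: c-lines contain c; side orbits carry no fixed point; T-line orbits pass through y_k and avoid c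
  have hcσ : ∀ v : L, c ∈ v → c ∈ σ.onLines v := fun v hv => by have := σ.mem_map hv; rwa [hc] at this
  have gfacts : ∀ s : Fin 2, ∀ g ∈ orb3 σ.onLines (cl u₀ u₁ s), c ∈ g := by
    intro s g hg
    have hcs := (σ.cl_spec hcu₀ hu₀ hcu₁ hu₁ s).1
    rw [mem_orb3] at hg
    rcases hg with rfl | rfl | rfl
    · exact hcs
    · exact hcσ _ hcs
    · exact hcσ _ (hcσ _ hcs)
  have sfacts : ∀ (s : Fin 2) (i : Fin 12), ∀ g ∈ orb3 σ.onLines (σ.sideOf l (σ.eTri7 h12 hcu₀ hu₀ hcu₁ hu₁ s i).1),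
      ∀ p : P, σ.onPoints p = p → p ∉ g := by
    intro s i g hg
    set x := σ.eTri7 h12 hcu₀ hu₀ hcu₁ hu₁ s i
    have hxX := σ.exterior_of_triIdx s x hcu₀ hu₀ hcu₁ hu₁ hL
    have hxf : σ.onPoints x.1 ≠ x.1 := σ.not_fixed_of_exterior_flag hl hP hxX
    obtain ⟨hxa, hσxa⟩ := σ.sideOf_spec l hxf
    exact σ.orb3_side_noFixed (σ.side_no_fixed_point hxf hxX hxa hσxa).2 hg
  have tfacts : ∀ (k : Fin 6) (t : Fin 4), ∀ g ∈ ((σ.eLOrb hl hcl hP hL h12 hq (σ.eFixP6 hl hc hf k) t).1 : Finset L),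
      (σ.eFixP6 hl hc hf k).1 ∈ g ∧ c ∉ g := by
    intro k t g hg
    set y := σ.eFixP6 hl hc hf k
    obtain ⟨b, hb, hbeq⟩ := mem_image.1 (σ.eLOrb hl hcl hP hL h12 hq y t).2
    rw [mem_filter] at hb
    rw [← hbeq, mem_orb3] at hg
    have hyσ : ∀ e : L, y.1 ∈ e → y.1 ∈ σ.onLines e := fun e he => by have := σ.mem_map he; rwa [y.2.1] at this
    have hlσ : ∀ e : L, e ≠ l → σ.onLines e ≠ l := fun e he h' => he (σ.onLines.injective (h'.trans hl.symm))
    have key : ∀ e : L, y.1 ∈ e → e ≠ l → y.1 ∈ e ∧ c ∉ e := fun e h1 h2 => ⟨h1, σ.c_not_mem_tline hcl hP y.2.1 y.2.2 h1 h2⟩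
    rcases hg with e | e | e <;> rw [e]
    · exact key b hb.2.1 hb.2.2
    · exact key _ (hyσ _ hb.2.1) (hlσ _ hb.2.2)
    · exact key _ (hyσ _ (hyσ _ hb.2.1)) (hlσ _ (hlσ _ hb.2.2))
  have tne : ∀ (k : Fin 6) (t : Fin 4), (((σ.eLOrb hl hcl hP hL h12 hq (σ.eFixP6 hl hc hf k) t).1 : Finset L)).Nonempty := fun k t => by
    obtain ⟨b, -, hbeq⟩ := mem_image.1 (σ.eLOrb hl hcl hP hL h12 hq (σ.eFixP6 hl hc hf k) t).2
    exact ⟨b, by rw [← hbeq]; exact self_mem_orb3 _ _⟩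
  rcases r₁ with s | ⟨s, i⟩ | ⟨k, t⟩ <;> rcases r₂ with s' | ⟨s', i'⟩ | ⟨k', t'⟩ <;>
    simp only [rowOrbit] at h
  · -- Γ / Γ
    by_contra hne
    have hss : s ≠ s' := fun e => hne (by rw [e])
    have key : ∀ {a b : Fin 2}, a ≠ b → orb3 σ.onLines (cl u₀ u₁ a) = orb3 σ.onLines (cl u₀ u₁ b) → False := by
      intro a b hab hab'
      fin_cases a <;> fin_cases b
      · exact hab rfl
      · apply h01
        have h' : orb3 σ.onLines u₀ = orb3 σ.onLines u₁ := hab'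
        rw [h']; exact self_mem_orb3 _ _
      · apply h01
        have h' : orb3 σ.onLines u₁ = orb3 σ.onLines u₀ := hab'
        rw [← h']; exact self_mem_orb3 _ _
      · exact hab rfl
    exact key hss h
  · exfalso
    exact sfacts s' i' _ (by rw [← h]; exact self_mem_orb3 _ _) c hc (gfacts s _ (self_mem_orb3 _ _))
  · exfalso
    obtain ⟨g, hg⟩ := tne k' t'
    have hg' := hg; rw [← h] at hg'
    exact (tfacts k' t' g hg).2 (gfacts s g hg')
  · exfalso
    exact sfacts s i _ (by rw [h]; exact self_mem_orb3 _ _) c hc (gfacts s' _ (self_mem_orb3 _ _))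
  · -- side / side
    set x := σ.eTri7 h12 hcu₀ hu₀ hcu₁ hu₁ s i with hx
    set x' := σ.eTri7 h12 hcu₀ hu₀ hcu₁ hu₁ s' i' with hx'
    have hxX := σ.exterior_of_triIdx s x hcu₀ hu₀ hcu₁ hu₁ hL
    have hx'X := σ.exterior_of_triIdx s' x' hcu₀ hu₀ hcu₁ hu₁ hL
    have hxf : σ.onPoints x.1 ≠ x.1 := σ.not_fixed_of_exterior_flag hl hP hxX
    have hx'f : σ.onPoints x'.1 ≠ x'.1 := σ.not_fixed_of_exterior_flag hl hP hx'X
    obtain ⟨hx'a', hσx'a'⟩ := σ.sideOf_spec l hx'f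
    have hmem : σ.sideOf l x'.1 ∈ orb3 σ.onLines (σ.sideOf l x.1) := by rw [h]; exact self_mem_orb3 _ _
    obtain ⟨R, hRx, hRg, hσRg⟩ := σ.side_of_mem_orb3_sideOf hq hxf hmem
    have hRX := σ.exterior_of_mem_orb3 hxX hRx
    have hx'R : x'.1 = R := σ.side_unique hRX hRg hσRg hx'a' hσx'a'
    have hx'x : x'.1 ∈ orb3 σ.onPoints x.1 := by rw [hx'R]; exact hRx
    by_cases hss : s = s'
    · subst hss
      have heq : x'.1 = x.1 := σ.vertex_eq_of_mem_orb3 hc hq (σ.cl_spec hcu₀ hu₀ hcu₁ hu₁ s).1 (σ.cl_spec hcu₀ hu₀ hcu₁ hu₁ s).2 x'.2.1 x.2.1 hx'x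
      have : i' = i := (σ.eTri7 h12 hcu₀ hu₀ hcu₁ hu₁ s).injective (Subtype.ext heq)
      rw [this]
    · exfalso
      have key : ∀ {a b : Fin 2}, a ≠ b → ∀ (xa : TriIdx (P := P) c (cl u₀ u₁ a)) (xb : TriIdx (P := P) c (cl u₀ u₁ b)),
          xb.1 ∈ orb3 σ.onPoints xa.1 → False := by
        intro a b hab xa xb hmem'
        fin_cases a <;> fin_cases b
        · exact hab rfl
        · exact σ.not_both_classes hc hq hcu₀ hu₀ hcu₁ h01 (self_mem_orb3 _ xa.1) xa.2.1 xa.2.2 hmem' xb.2.1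
        · exact σ.not_both_classes hc hq hcu₀ hu₀ hcu₁ h01 hmem' xb.2.1 xb.2.2 (self_mem_orb3 _ xa.1) xa.2.1
        · exact hab rfl
      exact key hss x x' hx'x
  · exfalso
    obtain ⟨g, hg⟩ := tne k' t'
    have hg' := hg; rw [← h] at hg'
    exact sfacts s i g hg' _ (σ.eFixP6 hl hc hf k').2.1 (tfacts k' t' g hg).1
  · exfalso
    obtain ⟨g, hg⟩ := tne k t
    have hg' := hg; rw [h] at hg'
    exact (tfacts k t g hg).2 (gfacts s' g hg')
  · exfalso
    obtain ⟨g, hg⟩ := tne k t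
    have hg' := hg; rw [h] at hg'
    exact sfacts s' i' g hg' _ (σ.eFixP6 hl hc hf k).2.1 (tfacts k t g hg).1
  · -- T / T
    obtain ⟨g, hg⟩ := tne k t
    have hg' := hg; rw [h] at hg'
    obtain ⟨hyg, -⟩ := tfacts k t g hg
    obtain ⟨hy'g, hcg⟩ := tfacts k' t' g hg'
    have hkk : k = k' := by
      by_contra hne
      have hyy : (σ.eFixP6 hl hc hf k).1 ≠ (σ.eFixP6 hl hc hf k').1 := fun e => hne ((σ.eFixP6 hl hc hf).injective (Subtype.ext e))
      -- two fixed points on g force g = l ∋ c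
      have hgl : g = l := (Nondegenerate.eq_or_eq hyg hy'g (hP _ (σ.eFixP6 hl hc hf k).2.1) (hP _ (σ.eFixP6 hl hc hf k').2.1)).resolve_left hyy
      exact hcg (hgl ▸ hcl)
    subst hkk
    have : t = t' := (σ.eLOrb hl hcl hP hL h12 hq (σ.eFixP6 hl hc hf k)).injective (Subtype.ext h)
    rw [this]

/-- **The row indexing is surjective** onto the non-trivial line orbits (`f = 7`): a non-fixed line is a c-line (class `0` or `1`), a
T-line through a fixed point `y ≠ c`, or an exterior line, i.e. a side of a triangle with a vertex on `u₀` or `u₁`. -/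
theorem exists_rowOrbit_eq (h01 : u₁ ∉ orb3 σ.onLines u₀) {B : Finset L} (hB : B ∈ σ.lineOrbits3) :
    ∃ r : F7Row, σ.rowOrbit hl hc hcl hP hL h12 hq hf hcu₀ hu₀ hcu₁ hu₁ r = B := by
  have hqL : σ.onLines ^ 3 = 1 := σ.onLines_pow_eq_one hq
  unfold lineOrbits3 at hB
  obtain ⟨m, hm, rfl⟩ := mem_image.1 hB
  rw [mem_filter] at hm
  obtain ⟨-, hmf⟩ := hm
  by_cases hcm : c ∈ m
  · -- a c-line: class 0 or class 1
    rcases σ.cline_mem_orb3_or hc hL h12 hq hf hcu₀ hu₀ hcu₁ hu₁ h01 hcm hmf with h0 | h1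
    · refine ⟨Sum.inl 0, ?_⟩
      have e0 : cl u₀ u₁ 0 = u₀ := rfl
      simp only [rowOrbit]
      rw [e0]; exact (orb3_eq_of_mem σ.onLines hqL h0).symm
    · refine ⟨Sum.inl 1, ?_⟩
      have e1 : cl u₀ u₁ 1 = u₁ := rfl
      simp only [rowOrbit]
      rw [e1]; exact (orb3_eq_of_mem σ.onLines hqL h1).symm
  · by_cases hfix : ∃ y : P, σ.onPoints y = y ∧ y ∈ m
    · -- a T-line through the fixed point y ≠ c
      obtain ⟨y, hy, hym⟩ := hfix
      have hyc : y ≠ c := fun e => hcm (e ▸ hym)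
      have hml : m ≠ l := fun e => hcm (e ▸ hcl)
      have hmem : orb3 σ.onLines m ∈ (univ.filter fun b : L => y ∈ b ∧ b ≠ l).image (orb3 σ.onLines) :=
        mem_image.2 ⟨m, mem_filter.2 ⟨mem_univ _, hym, hml⟩, rfl⟩
      set k := (σ.eFixP6 hl hc hf).symm ⟨y, hy, hyc⟩ with hk
      have hyk : σ.eFixP6 hl hc hf k = ⟨y, hy, hyc⟩ := by rw [hk, Equiv.apply_symm_apply]
      refine ⟨Sum.inr (Sum.inr (k, (σ.eLOrb hl hcl hP hL h12 hq (σ.eFixP6 hl hc hf k)).symm ⟨_, by rw [hyk]; exact hmem⟩)), ?_⟩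
      simp only [rowOrbit, Equiv.apply_symm_apply]
    · -- an exterior line: a side of the triangle of Q, whose vertex lies on u₀ or u₁
      push Not at hfix
      have hm0 : ∀ p : P, σ.onPoints p = p → p ∉ m := fun p hp => hfix p hp
      obtain ⟨Q, hQ, hQm, hσQm⟩ := σ.exterior_line_is_side hl hc hcl hP hL hmf hm0
      rcases σ.exterior_orbit_meets_clines hl hc hcl hL h12 hq hf hcu₀ hu₀ hcu₁ hu₁ h01 hQ.2 with ⟨x, hxQ, hxu⟩ | ⟨x, hxQ, hxu⟩
      · have hxX := σ.exterior_of_mem_orb3 hQ.2 hxQ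
        have hxc : x ≠ c := fun e => hxX l hl (e ▸ hcl)
        have hxf : σ.onPoints x ≠ x := σ.not_fixed_of_exterior_flag hl hP hxX
        have hQx : Q ∈ orb3 σ.onPoints x := by rw [orb3_eq_of_mem σ.onPoints hq hxQ]; exact self_mem_orb3 _ _
        have hmo : m ∈ orb3 σ.onLines (σ.sideOf l x) := σ.mem_orb3_sideOf_of_side hq hxf hQx hQ.1 hQm hσQm
        have hxu' : x ∈ cl u₀ u₁ 0 := by simp only [cl]; exact hxu
        refine ⟨Sum.inr (Sum.inl (0, (σ.eTri7 h12 hcu₀ hu₀ hcu₁ hu₁ 0).symm ⟨x, hxu', hxc⟩)), ?_⟩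
        simp only [rowOrbit, Equiv.apply_symm_apply]
        exact (orb3_eq_of_mem σ.onLines hqL hmo).symm
      · have hxX := σ.exterior_of_mem_orb3 hQ.2 hxQ
        have hxc : x ≠ c := fun e => hxX l hl (e ▸ hcl)
        have hxf : σ.onPoints x ≠ x := σ.not_fixed_of_exterior_flag hl hP hxX
        have hQx : Q ∈ orb3 σ.onPoints x := by rw [orb3_eq_of_mem σ.onPoints hq hxQ]; exact self_mem_orb3 _ _
        have hmo : m ∈ orb3 σ.onLines (σ.sideOf l x) := σ.mem_orb3_sideOf_of_side hq hxf hQx hQ.1 hQm hσQm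
        have hxu' : x ∈ cl u₀ u₁ 1 := by simp only [cl]; exact hxu
        refine ⟨Sum.inr (Sum.inl (1, (σ.eTri7 h12 hcu₀ hu₀ hcu₁ hu₁ 1).symm ⟨x, hxu', hxc⟩)), ?_⟩
        simp only [rowOrbit, Equiv.apply_symm_apply]
        exact (orb3_eq_of_mem σ.onLines hqL hmo).symm

end Data

end Flag

end Collineation

end Summit.Ventures.DiscreteObjects.PP12
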